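import Summits.MatrixMultiplication.MatrixMultiplication.Theorems.SoloInformedTwistedDoor
import Literature.Computability.AlgebraicComplexity.FlatteningBound

/-!
# The floor of the s-rank door: `R_s((T_cw,q^τ)^{⊗N}) ≥ (q+1)^N` for every re-weighting

Solo deliverable (informed mode).  The s-rank door asks for `R_s(T_cw,2^{⊗N}) = 3^{(1+o(1))N}`.
This file proves that `3^N` is a FLOOR: for every `q ≥ 1`, every twist `τ` and every `N`, every
tensor with the support of `(T_cw,q^τ)^{⊗N}` has `(q+1)^N` linearly independent slices, hence rank
`≥ (q+1)^N`; so `R_s((T_cw,q^τ)^{⊗N}) ≥ (q+1)^N`, and the same for the Levi-Civita-pattern tensor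
`P` (`3^N`).  The mechanism is support-only (Cohn–Umans 2013, remark before Prop. 5, for
`⟨n,n,n⟩`): in `supp T_cw,q^τ` the first coordinate is DETERMINED by the other two, a property
inherited by Kronecker powers, so distinct slices have disjoint supports and every slice has a
private non-zero entry.  Consequently the door `σ(T_cw,2) = 3` asks for the flattening floor to be
attained asymptotically by re-weightings — exactly as the rank door `R̃(T_cw,2) = 3` asks for it to
be attained by `T_cw,2^{⊗N}` itself.

## References
* H. Cohn, C. Umans, *Fast matrix multiplication using coherent configurations*, SODA 2013,
  arXiv:1207.6528, §3 (remark before Prop. 5). [CohnUmans2013]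
* M. Bläser, *Fast Matrix Multiplication*, Theory of Computing Graduate Surveys 5 (2013), §7.
  [Blaser2013]
-/

noncomputable section

open scoped BigOperators
open Finset

namespace Summit.MatrixMultiplication.MatrixMultiplication.Theorems.SupportRankDoor

open Literature.Computability.AlgebraicComplexity

universe u

variable {K : Type u} [Field K]

/-! ## Supports in which the first index is determined by the other two -/

section Determined

variable {ι κ μ : Type}

/-- **Private entries give independent slices.** If in `supp t` the first coordinate is determined
by the other two, and every slice of `t` is non-zero, then every tensor `t'` with `supp t' = supp t`
has linearly independent slices. [cite: CohnUmans2013, §3 (before Prop. 5)] -/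
theorem linearIndependent_slices_of_sameSupport_of_determined [Fintype ι]
    {t t' : ι → κ → μ → K}
    (hdet : ∀ i i' j k, t i j k ≠ 0 → t i' j k ≠ 0 → i = i')
    (hnz : ∀ i, ∃ j k, t i j k ≠ 0) (h : SameSupport t t') :
    LinearIndependent K (fun i => t' i : ι → κ → μ → K) := by
  classical
  rw [Fintype.linearIndependent_iff]
  intro g hg i
  obtain ⟨j, k, hijk⟩ := hnz i
  have h0 := congr_fun (congr_fun hg j) k
  rw [Finset.sum_apply, Finset.sum_apply, Fintype.sum_eq_single i] at h0
  · have hne : t' i j k ≠ 0 := (h i j k).1 hijk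
    rw [Pi.smul_apply, Pi.smul_apply, Pi.zero_apply, Pi.zero_apply, smul_eq_mul] at h0
    exact (mul_eq_zero.1 h0).resolve_right hne
  · intro i' hi'
    have hzero : t' i' j k = 0 := by
      by_contra hz
      exact hi' (hdet i' i j k ((h i' j k).2 hz) hijk)
    rw [Pi.smul_apply, Pi.smul_apply, smul_eq_mul, hzero, mul_zero]

/-- **`R_s(t) ≥ |ι|`** for such supports: the slice (flattening) lower bound holds for every
re-weighting. [cite: Blaser2013, §7 (proof of Lemma 7.1 (2))] -/
theorem card_le_supportRank_of_determined [Fintype ι] [Fintype κ] [Fintype μ]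
    {t : ι → κ → μ → K}
    (hdet : ∀ i i' j k, t i j k ≠ 0 → t i' j k ≠ 0 → i = i')
    (hnz : ∀ i, ∃ j k, t i j k ≠ 0) : Fintype.card ι ≤ supportRank t := by
  unfold supportRank
  refine le_csInf ⟨_, t, SameSupport.refl _, rfl⟩ ?_
  rintro _ ⟨t', ht', rfl⟩
  exact card_le_tensorRank_of_linearIndependent t'
    (linearIndependent_slices_of_sameSupport_of_determined hdet hnz ht')

/-- Determinedness of the first index is inherited by Kronecker powers.
[cite: CohnUmans2013, §3 (before Prop. 5)] -/
theorem kroneckerPow_determined {t : ι → κ → μ → K}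
    (hdet : ∀ i i' j k, t i j k ≠ 0 → t i' j k ≠ 0 → i = i') (N : ℕ) :
    ∀ a a' b c, kroneckerPow t N a b c ≠ 0 → kroneckerPow t N a' b c ≠ 0 → a = a' := by
  intro a a' b c h h'
  rw [kroneckerPow_apply] at h h'
  funext ρ
  exact hdet _ _ _ _ (fun h0 => h (Finset.prod_eq_zero (Finset.mem_univ ρ) h0))
    (fun h0 => h' (Finset.prod_eq_zero (Finset.mem_univ ρ) h0))

/-- Non-vanishing of slices is inherited by Kronecker powers (over a field).
[cite: CohnUmans2013, §3 (before Prop. 5)] -/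
theorem kroneckerPow_slices_ne_zero {t : ι → κ → μ → K} (hnz : ∀ i, ∃ j k, t i j k ≠ 0) (N : ℕ) :
    ∀ a : Fin N → ι, ∃ b c, kroneckerPow t N a b c ≠ 0 := by
  classical
  intro a
  choose j k hjk using hnz
  refine ⟨fun ρ => j (a ρ), fun ρ => k (a ρ), ?_⟩
  rw [kroneckerPow_apply]
  exact Finset.prod_ne_zero_iff.2 fun ρ _ => hjk (a ρ)

/-- **`R_s(t^{⊗N}) ≥ |ι|^N`** for supports with determined first index and non-zero slices.
[cite: CohnUmans2013, §3 (before Prop. 5)] -/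
theorem card_pow_le_supportRank_kroneckerPow [Fintype ι] [Fintype κ] [Fintype μ]
    {t : ι → κ → μ → K}
    (hdet : ∀ i i' j k, t i j k ≠ 0 → t i' j k ≠ 0 → i = i')
    (hnz : ∀ i, ∃ j k, t i j k ≠ 0) (N : ℕ) :
    Fintype.card ι ^ N ≤ supportRank (kroneckerPow t N) := by
  classical
  have h := card_le_supportRank_of_determined (kroneckerPow_determined hdet N)
    (kroneckerPow_slices_ne_zero hnz N)
  simpa [Fintype.card_fin] using h

end Determined

/-! ## The twisted Coppersmith–Winograd supports -/

/-- In `supp T_cw,q^τ` the first index is a function of the other two.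
[cite: BurgisserClausenShokrollahi1997, §15.8 (p. 383)] -/
theorem twistedCwTensor_fst_eq (q : ℕ) (τ : Equiv.Perm (Fin q)) {i j k : Fin (q + 1)}
    (h : twistedCwTensor K q τ i j k ≠ 0) :
    i = if j = 0 then k else if k = 0 then twistSucc τ j else 0 := by
  rw [twistedCwTensor_apply] at h
  split_ifs at h with hc
  · rcases hc with ⟨hi, hjk, hj⟩ | ⟨hj, hik, -⟩ | ⟨hk, hj, hi⟩
    · rw [if_neg hj, if_neg (fun hk => hj (hjk.trans hk))]
      exact hi
    · rw [if_pos hj]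
      exact hik
    · rw [if_neg hj, if_pos hk]
      exact hi
  · exact absurd rfl h

/-- Hence two non-zero entries of `T_cw,q^τ` with the same second and third index have the same
first index. [cite: BurgisserClausenShokrollahi1997, §15.8 (p. 383)] -/
theorem twistedCwTensor_determined (q : ℕ) (τ : Equiv.Perm (Fin q)) :
    ∀ i i' j k : Fin (q + 1), twistedCwTensor K q τ i j k ≠ 0 →
      twistedCwTensor K q τ i' j k ≠ 0 → i = i' := by
  intro i i' j k h h'
  rw [twistedCwTensor_fst_eq q τ h, twistedCwTensor_fst_eq q τ h']

/-- Every slice of `T_cw,q^τ` is non-zero (`q ≥ 1`): `T(0,1,1) = 1` and `T(a,0,a) = 1` for `a ≠ 0`.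
[cite: BurgisserClausenShokrollahi1997, §15.8 (p. 383)] -/
theorem twistedCwTensor_slices_ne_zero {q : ℕ} (hq : 1 ≤ q) (τ : Equiv.Perm (Fin q)) :
    ∀ i : Fin (q + 1), ∃ j k, twistedCwTensor K q τ i j k ≠ 0 := by
  intro i
  by_cases hi : i = 0
  · refine ⟨(⟨0, hq⟩ : Fin q).succ, (⟨0, hq⟩ : Fin q).succ, ?_⟩
    rw [hi, twistedCwTensor_zero_succ_succ, if_pos rfl]
    exact one_ne_zero
  · refine ⟨0, i, ?_⟩
    rw [twistedCwTensor_apply, if_pos (Or.inr (Or.inl ⟨rfl, rfl, hi⟩))]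
    exact one_ne_zero

/-- **Floor of the twisted doors: `R_s((T_cw,q^τ)^{⊗N}) ≥ (q+1)^N`** for `q ≥ 1`, every `τ`, `N`.
[cite: CohnUmans2013, §3 (before Prop. 5)] -/
theorem pow_le_supportRank_kroneckerPow_twisted {q : ℕ} (hq : 1 ≤ q) (τ : Equiv.Perm (Fin q))
    (N : ℕ) : (q + 1) ^ N ≤ supportRank (kroneckerPow (twistedCwTensor K q τ) N) := by
  have h := card_pow_le_supportRank_kroneckerPow (twistedCwTensor_determined (K := K) q τ)
    (twistedCwTensor_slices_ne_zero hq τ) N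
  simpa [Fintype.card_fin] using h

/-- **Floor of the s-rank door: `R_s(T_cw,q^{⊗N}) ≥ (q+1)^N`** (`q ≥ 1`); every re-weighting
`T'` of `supp T_cw,q^{⊗N}` has `R(T') ≥ (q+1)^N`. [cite: CohnUmans2013, §3 (before Prop. 5)] -/
theorem pow_le_supportRank_kroneckerPow_cwTensor {q : ℕ} (hq : 1 ≤ q) (N : ℕ) :
    (q + 1) ^ N ≤ supportRank (kroneckerPow (cwTensor K q) N) := by
  rw [← twistedCwTensor_one]
  exact pow_le_supportRank_kroneckerPow_twisted hq 1 N

/-- `3^N ≤ R_s(T_cw,2^{⊗N})`: the door `σ(T_cw,2) = 3` sits exactly at the floor.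
[cite: CohnUmans2013, §3 (before Prop. 5)] -/
theorem three_pow_le_supportRank_kroneckerPow_cwTensor_two (N : ℕ) :
    3 ^ N ≤ supportRank (kroneckerPow (cwTensor K 2) N) := by
  simpa using pow_le_supportRank_kroneckerPow_cwTensor (K := K) (q := 2) one_le_two N

/-- Every re-weighting `T'` of `supp T_cw,2^{⊗N}` has rank `≥ 3^N`.
[cite: CohnUmans2013, §3 (before Prop. 5)] -/
theorem three_pow_le_tensorRank_of_sameSupport_cwTensor_two_pow (N : ℕ)
    {T' : (Fin N → Fin 3) → (Fin N → Fin 3) → (Fin N → Fin 3) → K}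
    (h : SameSupport (kroneckerPow (cwTensor K 2) N) T') : 3 ^ N ≤ tensorRank T' :=
  (three_pow_le_supportRank_kroneckerPow_cwTensor_two N).trans
    ((supportRank_le_of_sameSupport h le_rfl))

/-! ## The Levi-Civita support -/

/-- In `supp P` (the six permutations) the first index is determined by the other two.
[cite: ConnerGesmundoLandsbergVentura2022, §1] -/
theorem lcTensor_determined :
    ∀ i i' j k : Fin 3, lcTensor K i j k ≠ 0 → lcTensor K i' j k ≠ 0 → i = i' := by
  have key : ∀ i i' j k : Fin 3, (i ≠ j ∧ j ≠ k ∧ i ≠ k) → (i' ≠ j ∧ j ≠ k ∧ i' ≠ k) → i = i' := by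
    decide
  intro i i' j k h h'
  simp only [lcTensor, ne_eq, ite_eq_right_iff, one_ne_zero, imp_false, not_not] at h h'
  exact key i i' j k h h'

/-- Every slice of `P` is non-zero. [cite: ConnerGesmundoLandsbergVentura2022, §1] -/
theorem lcTensor_slices_ne_zero : ∀ i : Fin 3, ∃ j k, lcTensor K i j k ≠ 0 := by
  have key : ∀ i : Fin 3, ∃ j k : Fin 3, i ≠ j ∧ j ≠ k ∧ i ≠ k := by decide
  intro i
  obtain ⟨j, k, h⟩ := key i
  refine ⟨j, k, ?_⟩
  simp only [lcTensor, if_pos h]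
  exact one_ne_zero

/-- **Floor of the Levi-Civita door: `R_s(P^{⊗N}) ≥ 3^N`.**
[cite: CohnUmans2013, §3 (before Prop. 5)] -/
theorem three_pow_le_supportRank_kroneckerPow_lcTensor (N : ℕ) :
    3 ^ N ≤ supportRank (kroneckerPow (lcTensor K) N) := by
  have h := card_pow_le_supportRank_kroneckerPow (lcTensor_determined (K := K))
    lcTensor_slices_ne_zero N
  simpa [Fintype.card_fin] using h

end Summit.MatrixMultiplication.MatrixMultiplication.Theorems.SupportRankDoor

end
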